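import Summits.ValiantsHypothesis.ValiantsHypothesis.Theorems.RigidityForcesSymmetryGrenetFirstOrderRankRigidBlockIIShape
import Summits.ValiantsHypothesis.ValiantsHypothesis.Theorems.RigidityForcesSymmetryGrenetFirstOrderRankRigidWordEval

/-!
# Route RigidityForcesSymmetry — `GrenetFirstOrderRankRigid` (item stmt-ValiantsHypothesis-21029),
line `grenet_gauge`: stub `stub_linearRigid`, step 5 (block II) — slices of a permutation and the
weights of the block-II entries

For the crux line `Cruxes/GrenetFirstOrderRankRigid/Lines/grenet_gauge.lean` (blueprint
`Lines/grenet_gauge-stub_linearRigid-PROOF.md`, §5, block II).  Bookkeeping for the permutation designs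
of the overlap block II: the SLICES `π({s ≤ c < t})` of a permutation `π` (`permSlice_*`), the
path counts `W X Y` at a permutation point in terms of slices (`evalPerm_grenet_W`), and the converse
of `blockII_tail_shape` / `blockII_head_shape`: the entries `ρ[C', α]` (row `(A ∪ C') - α`, column `C'`,
variable `(α, u-1)`) and `κ[C', β]` (row `A ∪ C'`, column `C' + β`, variable `(β, k₀)`) have the
indicator weight of the block `(A, k₀)` (`blockII_weight_of_tail`, `blockII_weight_of_head`).
No new definitions.  VP ≠ VNP is not moved by this file.
-/

noncomputable section

open MvPolynomial Matrix Finset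

namespace Summit.ValiantsHypothesis.Theorems.RigidityForcesSymmetry.GrenetGauge

open Literature.Computability.AlgebraicComplexity

/-! ### Slices of a permutation -/

section Slices

variable {n : ℕ} (π : Equiv.Perm (Fin n))

/-- Membership in a slice `π({s ≤ c < t})`. [folklore] -/
theorem mem_permSlice (s t : ℕ) (x : Fin n) :
    x ∈ (univ.filter fun c : Fin n => s ≤ (c : ℕ) ∧ (c : ℕ) < t).image π ↔
      s ≤ ((π.symm x : Fin n) : ℕ) ∧ ((π.symm x : Fin n) : ℕ) < t := by
  simp only [Finset.mem_image, Finset.mem_filter, Finset.mem_univ, true_and]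
  constructor
  · rintro ⟨c, hc, rfl⟩; rwa [Equiv.symm_apply_apply]
  · intro h; exact ⟨π.symm x, h, Equiv.apply_symm_apply π x⟩

/-- The slice from `0` is the prefix image. [folklore] -/
theorem permSlice_zero (t : ℕ) :
    (univ.filter fun c : Fin n => 0 ≤ (c : ℕ) ∧ (c : ℕ) < t).image π
      = (univ.filter fun c : Fin n => (c : ℕ) < t).image π :=
  congrArg _ (Finset.filter_congr fun c _ => by simp)

/-- Consecutive slices glue. [folklore] -/
theorem permSlice_union {s t r : ℕ} (hst : s ≤ t) (htr : t ≤ r) :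
    (univ.filter fun c : Fin n => s ≤ (c : ℕ) ∧ (c : ℕ) < t).image π ∪
        (univ.filter fun c : Fin n => t ≤ (c : ℕ) ∧ (c : ℕ) < r).image π
      = (univ.filter fun c : Fin n => s ≤ (c : ℕ) ∧ (c : ℕ) < r).image π := by
  rw [← Finset.image_union]
  congr 1
  ext c; simp only [Finset.mem_union, Finset.mem_filter, Finset.mem_univ, true_and]; omega

/-- Consecutive slices are disjoint. [folklore] -/
theorem permSlice_disjoint {s t r : ℕ} :
    Disjoint ((univ.filter fun c : Fin n => s ≤ (c : ℕ) ∧ (c : ℕ) < t).image π)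
      ((univ.filter fun c : Fin n => t ≤ (c : ℕ) ∧ (c : ℕ) < r).image π) := by
  rw [Finset.disjoint_left]
  intro x h1 h2
  rw [mem_permSlice] at h1 h2
  omega

/-- Peeling the first letter of a slice. [folklore] -/
theorem permSlice_succ_left {s t : ℕ} (hst : s < t) (hs : s < n) :
    (univ.filter fun c : Fin n => s ≤ (c : ℕ) ∧ (c : ℕ) < t).image π
      = insert (π ⟨s, hs⟩) ((univ.filter fun c : Fin n => s + 1 ≤ (c : ℕ) ∧ (c : ℕ) < t).image π) := by
  ext x
  rw [mem_permSlice, Finset.mem_insert, mem_permSlice]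
  constructor
  · intro h
    by_cases hx : ((π.symm x : Fin n) : ℕ) = s
    · left; rw [← Equiv.apply_symm_apply π x]; congr 1; exact Fin.ext hx
    · right; omega
  · rintro (rfl | h)
    · rw [Equiv.symm_apply_apply]; simp only; omega
    · omega

/-- Peeling the last letter of a slice. [folklore] -/
theorem permSlice_succ_right {s t : ℕ} (hst : s < t) (ht : t ≤ n) :
    (univ.filter fun c : Fin n => s ≤ (c : ℕ) ∧ (c : ℕ) < t).image π
      = insert (π ⟨t - 1, by omega⟩) ((univ.filter fun c : Fin n => s ≤ (c : ℕ) ∧ (c : ℕ) < t - 1).image π) := by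
  ext x
  rw [mem_permSlice, Finset.mem_insert, mem_permSlice]
  constructor
  · intro h
    by_cases hx : ((π.symm x : Fin n) : ℕ) = t - 1
    · left; rw [← Equiv.apply_symm_apply π x]; congr 1; exact Fin.ext hx
    · right; omega
  · rintro (rfl | h)
    · rw [Equiv.symm_apply_apply]; simp only; omega
    · omega

/-- The letter at a position is not in a slice ending before it. [folklore] -/
theorem perm_notMem_permSlice_of_ge {s t : ℕ} (c : Fin n) (hc : t ≤ (c : ℕ)) :
    π c ∉ (univ.filter fun c : Fin n => s ≤ (c : ℕ) ∧ (c : ℕ) < t).image π := by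
  rw [mem_permSlice, Equiv.symm_apply_apply]; omega

/-- The letter at a position is not in a slice starting after it. [folklore] -/
theorem perm_notMem_permSlice_of_lt {s t : ℕ} (c : Fin n) (hc : (c : ℕ) < s) :
    π c ∉ (univ.filter fun c : Fin n => s ≤ (c : ℕ) ∧ (c : ℕ) < t).image π := by
  rw [mem_permSlice, Equiv.symm_apply_apply]; omega

/-- The final slice is the complement of the prefix. [folklore] -/
theorem permSlice_to_top (s : ℕ) :
    (univ.filter fun c : Fin n => s ≤ (c : ℕ) ∧ (c : ℕ) < n).image π
      = ((univ.filter fun c : Fin n => (c : ℕ) < s).image π)ᶜ := by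
  ext x
  rw [mem_permSlice, Finset.mem_compl, Grenet.mem_prefix_image]
  have := (π.symm x).isLt
  omega

/-- The cardinality of a slice. [folklore] -/
theorem card_permSlice {s t : ℕ} (ht : t ≤ n) (hst : s ≤ t) :
    ((univ.filter fun c : Fin n => s ≤ (c : ℕ) ∧ (c : ℕ) < t).image π).card = t - s := by
  rw [Finset.card_image_of_injective _ π.injective]
  have : (univ.filter fun c : Fin n => s ≤ (c : ℕ) ∧ (c : ℕ) < t)
      = (univ.filter fun c : Fin n => (c : ℕ) < t) \ (univ.filter fun c : Fin n => (c : ℕ) < s) := by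
    ext c; simp only [Finset.mem_filter, Finset.mem_univ, true_and, Finset.mem_sdiff]; omega
  rw [this, Finset.card_sdiff_of_subset (fun c hc => by
      simp only [Finset.mem_filter, Finset.mem_univ, true_and] at hc ⊢; omega),
    Fin.card_filter_val_lt, Fin.card_filter_val_lt, min_eq_right ht, min_eq_right (hst.trans ht)]

end Slices

/-! ### Path counts at a permutation point -/

section PermEval

variable (k : Type*) [CommRing k] {n : ℕ}

/-- **The path matrix at a permutation point**: `W X Y` (`|X| ≤ |Y|`) at `x_{p,c} := [π c = p]` is
`[π({|X| ≤ c < |Y|}) is disjoint from X with union Y]` (the unique candidate path reads `π`).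
[folklore] -/
theorem evalPerm_grenet_W (π : Equiv.Perm (Fin n)) (X Y : Finset (Fin n)) (hXY : X.card ≤ Y.card) :
    eval (fun v : Fin n × Fin n => if π v.2 = v.1 then (1 : k) else 0) ((1 - Grenet.adj k n).adjugate X Y)
      = if Disjoint X ((univ.filter fun c : Fin n => X.card ≤ (c : ℕ) ∧ (c : ℕ) < Y.card).image π) ∧
            X ∪ (univ.filter fun c : Fin n => X.card ≤ (c : ℕ) ∧ (c : ℕ) < Y.card).image π = Y then 1 else 0 := by
  have hYn : Y.card ≤ n := (Finset.card_le_univ Y).trans_eq (Fintype.card_fin n)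
  rw [Grenet.adjugate_one_sub (Grenet.wt k n) (grenet_adj_shape k n), Matrix.sum_apply, map_sum,
    Finset.sum_eq_single_of_mem (Y.card - X.card) (Finset.mem_range.mpr (by omega))]
  · rw [evalWord_grenet_adj_pow k π X Y (by omega)]
    have hinj : Function.Injective (fun t : Fin (Y.card - X.card) => π ⟨X.card + (t : ℕ), by omega⟩) :=
      fun t₁ t₂ h => by have := Fin.mk.inj_iff.mp (π.injective h); exact Fin.ext (by omega)
    have hfilt : (univ.filter fun i : Fin n => X.card ≤ (i : ℕ) ∧ (i : ℕ) < X.card + (Y.card - X.card))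
        = univ.filter fun c : Fin n => X.card ≤ (c : ℕ) ∧ (c : ℕ) < Y.card :=
      Finset.filter_congr fun c _ => by omega
    have havoid : (∀ t : Fin (Y.card - X.card), π ⟨X.card + (t : ℕ), by omega⟩ ∉ X)
        ↔ Disjoint X ((univ.filter fun c : Fin n => X.card ≤ (c : ℕ) ∧ (c : ℕ) < Y.card).image π) := by
      rw [← hfilt, ← image_word_shift π (by omega), Finset.disjoint_left]
      constructor
      · intro h x hxX hx
        obtain ⟨t, -, rfl⟩ := Finset.mem_image.mp hx
        exact h t hxX
      · intro h t ht
        exact h ht (Finset.mem_image_of_mem _ (Finset.mem_univ t))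
    simp only [hinj, true_and, hfilt, havoid]
  · intro m hm hne
    rw [eval_grenet_adj_pow]
    refine Finset.sum_eq_zero fun g _ => if_neg ?_
    rintro ⟨hg, hgS, hST'⟩
    have h := card_eq_of_pathCondition hg hgS hST'
    exact hne (by omega)

end PermEval

/-! ### The block-II entries have the block weight -/

section Weights

variable {n : ℕ}

/-- **The tail entries `ρ[C', α]` have the weight of the block `(A, k₀)`**: row `(A ∪ C') - α`,
column `C'` (`C' ⊆ Aᶜ`, `|C'| = k₀`), variable `(α, u - 1)` with `u = |A| + k₀ ≤ n`, `α ∈ A ∪ C'`.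
[folklore] -/
theorem blockII_weight_of_tail (A C S : Finset (Fin n)) {k₀ : ℕ} (hk : 0 < A.card)
    (hC : C ⊆ Aᶜ) (hCk : C.card = k₀) (v : Fin n × Fin n) (hα : v.1 ∉ S) (hS : insert v.1 S = A ∪ C)
    (hq : (v.2 : ℕ) = A.card + k₀ - 1) :
    (∀ j' : Fin n, (if j' ∈ S then 1 else 0) + (if j' ∈ C then 0 else 1) + (if j' = v.1 then 1 else 0)
      = 1 + (if j' ∈ A then 1 else 0)) ∧
    (∀ c' : Fin n, (if (c' : ℕ) < S.card then 1 else 0) + (if C.card ≤ (c' : ℕ) then 1 else 0)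
      + (if c' = v.2 then 1 else 0) = 1 + (if k₀ ≤ (c' : ℕ) ∧ (c' : ℕ) < A.card + k₀ then 1 else 0)) := by
  have hdisj : Disjoint A C := Finset.disjoint_left.mpr fun x hxA hxC => (Finset.mem_compl.mp (hC hxC)) hxA
  have hScard : S.card = A.card + k₀ - 1 := by
    have := congrArg Finset.card hS
    rw [Finset.card_insert_of_notMem hα, Finset.card_union_of_disjoint hdisj, hCk] at this; omega
  have hvAC : v.1 ∈ A ∪ C := by rw [← hS]; exact Finset.mem_insert_self _ _
  have hjS : ∀ j', j' ≠ v.1 → (j' ∈ S ↔ j' ∈ A ∪ C) := fun j' hj' => by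
    rw [← hS, Finset.mem_insert]
    exact ⟨Or.inr, fun h => h.resolve_left hj'⟩
  constructor
  · intro j'
    by_cases h3 : j' = v.1
    · have hjS' : j' ∉ S := by rw [h3]; exact hα
      rcases Finset.mem_union.mp hvAC with hA' | hC'
      · have hjA : j' ∈ A := by rw [h3]; exact hA'
        have hjC : j' ∉ C := fun h => Finset.disjoint_left.mp hdisj hjA h
        rw [if_neg hjS', if_neg hjC, if_pos h3, if_pos hjA]
      · have hjC : j' ∈ C := by rw [h3]; exact hC'
        have hjA : j' ∉ A := fun h => Finset.disjoint_left.mp hdisj h hjC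
        rw [if_neg hjS', if_pos hjC, if_pos h3, if_neg hjA]
    · rw [if_neg h3]
      by_cases h1 : j' ∈ A
      · rw [if_pos ((hjS j' h3).mpr (Finset.mem_union.mpr (Or.inl h1))), if_pos h1,
          if_neg (fun h => Finset.disjoint_left.mp hdisj h1 h)]
      · rw [if_neg h1]
        by_cases h2 : j' ∈ C
        · rw [if_pos ((hjS j' h3).mpr (Finset.mem_union.mpr (Or.inr h2))), if_pos h2]
        · rw [if_neg (fun h => (Finset.mem_union.mp ((hjS j' h3).mp h)).elim h1 h2), if_neg h2]
  · intro c'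
    rw [hScard, hCk]
    have e3 : (c' = v.2) = ((c' : ℕ) = (v.2 : ℕ)) := propext Fin.ext_iff
    simp only [e3, hq]
    split_ifs <;> omega

/-- **The head entries `κ[C', β]` have the weight of the block `(A, k₀)`**: row `A ∪ C'`, column
`C' + β` (`β ∉ C'`), variable `(β, k₀)`. [folklore] -/
theorem blockII_weight_of_head (A C T : Finset (Fin n)) {k₀ : ℕ} (hk : 0 < A.card)
    (hC : C ⊆ Aᶜ) (hCk : C.card = k₀) (v : Fin n × Fin n) (hβ : v.1 ∈ T) (hT : T.erase v.1 = C)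
    (hq : (v.2 : ℕ) = k₀) :
    (∀ j' : Fin n, (if j' ∈ A ∪ C then 1 else 0) + (if j' ∈ T then 0 else 1) + (if j' = v.1 then 1 else 0)
      = 1 + (if j' ∈ A then 1 else 0)) ∧
    (∀ c' : Fin n, (if (c' : ℕ) < (A ∪ C).card then 1 else 0) + (if T.card ≤ (c' : ℕ) then 1 else 0)
      + (if c' = v.2 then 1 else 0) = 1 + (if k₀ ≤ (c' : ℕ) ∧ (c' : ℕ) < A.card + k₀ then 1 else 0)) := by
  have hdisj : Disjoint A C := Finset.disjoint_left.mpr fun x hxA hxC => (Finset.mem_compl.mp (hC hxC)) hxA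
  have hUcard : (A ∪ C).card = A.card + k₀ := by rw [Finset.card_union_of_disjoint hdisj, hCk]
  have hTcard : T.card = k₀ + 1 := by
    have h1 := Finset.card_erase_of_mem hβ
    rw [hT, hCk] at h1
    have h2 := Finset.card_pos.mpr ⟨_, hβ⟩
    omega
  have hβC : v.1 ∉ C := by rw [← hT]; exact Finset.notMem_erase _ _
  have hjT : ∀ j', j' ≠ v.1 → (j' ∈ T ↔ j' ∈ C) := fun j' hj' => by
    rw [← hT, Finset.mem_erase]
    exact ⟨fun h => ⟨hj', h⟩, fun h => h.2⟩
  constructor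
  · intro j'
    by_cases h3 : j' = v.1
    · have hjT' : j' ∈ T := by rw [h3]; exact hβ
      have hjC : j' ∉ C := by rw [h3]; exact hβC
      by_cases h1 : j' ∈ A
      · rw [if_pos (Finset.mem_union.mpr (Or.inl h1)), if_pos hjT', if_pos h3, if_pos h1]
      · rw [if_neg (fun h => (Finset.mem_union.mp h).elim h1 hjC), if_pos hjT', if_pos h3, if_neg h1]
    · by_cases h1 : j' ∈ A
      · rw [if_pos (Finset.mem_union.mpr (Or.inl h1)), if_pos h1, if_neg h3,
          if_neg (fun h => Finset.disjoint_left.mp hdisj h1 ((hjT j' h3).mp h))]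
      · rw [if_neg h1, if_neg h3]
        by_cases h2 : j' ∈ C
        · rw [if_pos (Finset.mem_union.mpr (Or.inr h2)), if_pos ((hjT j' h3).mpr h2)]
        · rw [if_neg (fun h => (Finset.mem_union.mp h).elim h1 h2), if_neg (fun h => h2 ((hjT j' h3).mp h))]
  · intro c'
    rw [hUcard, hTcard]
    have e3 : (c' = v.2) = ((c' : ℕ) = (v.2 : ℕ)) := propext Fin.ext_iff
    simp only [e3, hq]
    split_ifs <;> omega

end Weights

end Summit.ValiantsHypothesis.Theorems.RigidityForcesSymmetry.GrenetGauge
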